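import Summits.AtomisticToContinuum.BoseEinsteinCondensation.Theorems.BECThomsonPrincipleGDTransferSeededInteractionLocalityInt
import Summits.AtomisticToContinuum.BoseEinsteinCondensation.Theorems.BECThomsonPrincipleGDTransferSeededSmoothSplitting

/-!
# Route `BECThomsonPrinciple`, crux `GDTransfer` (stmt-AtomisticToContinuum-9482), line `seeded-continuity`:
# sub-goal `smoothSplittingInt` — the smooth splitting inequality for the INTEGRABLE class

Supports (does not close) stmt-AtomisticToContinuum-9482: proves the registered sub-goal
`smoothSplittingInt : SmoothSplittingInt` of the eighth Defs file `…SeededSpectralIntDefs` — the twin of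
`smoothSplitting` (`…SeededSmoothSplitting`) with the class hypothesis `IsFiniteContinuous v` replaced by
`IsIntegrableProfile v` (finite on `[0, ∞)`, integrable lift `‖v‖₁ = ∫_{ℝ³} v(|x|) dx < ∞`).

The IMS computation of `smoothSplitting` is reused verbatim (`SmoothCut.tform_sum_sum`, `re_sum_sum`,
`smoothBlock_eq_sum`, `self_eq_sum`, `tform_sectorBlock_ne`, `ims_sum_le` see `v` not at all or only through
measurability).  The four `v`-dependent inputs are re-proved for the integrable class, where the real interaction
`W = Σ_{p<q} v^per(x_p − x_q)` is FINITE everywhere (`PlainInteraction.periodizedPotential_ne_top_of_finite`) and in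
`L¹(cell^N)` (`lintegral_cellN_periodicInteraction_ne_top_of_lintegral_ne_top`) instead of continuous:
* sesquilinear expansion of `𝓥` over the sector blocks (`form_sum_left_int` / `form_sum_right_int`);
* `Q_S`-bandwidth two of `𝓥` at the level of sectors (`vform_sectorBlock_far`), entry by entry from the landed
  sibling sub-goal `interactionLocalityInt` (`…SeededInteractionLocalityInt`: integrable pair weights, `P_l`
  self-adjoint with one integrable entry);
* weighted Cauchy–Schwarz `|Re 𝓥(f, g)| ≤ (Re 𝓥(f,f) + Re 𝓥(g,g))/2` (`norm_form_le_sqrt_mul_sqrt_int`);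
* `∫⁻ W|h|² = ofReal (Re 𝓥(h, h))` and finiteness of the energy form of a `C¹` function
  (`ofReal_integral_weight_norm_sq_int`).
All [folklore] (CyconFroeseKirschSimon1987 §3.1, IMS localisation; ReedSimonIV1978 §XIII.12; LSSY2005 App. A).
-/

noncomputable section

open MeasureTheory Filter
open scoped ENNReal NNReal ComplexConjugate

namespace Summit.AtomisticToContinuum.BoseEinsteinCondensation.Cruxes.GDTransfer.Seeded

namespace SmoothCutInt

open Literature.MathematicalPhysics.QuantumManyBody.BoseGas
open Summit.AtomisticToContinuum.BoseEinsteinCondensation.Theorems.GaussianDominationCan.Negative (modeProj)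
open Summit.AtomisticToContinuum.BoseEinsteinCondensation.Cruxes.GDTransfer.DysonDressedWitness
open ChordVariation (continuous_modeProj)

variable {m : ℕ} {L : ℝ} {v : ℝ → ℝ≥0∞}

/-! ## The real interaction of an integrable profile: finite everywhere, integrable on the cell -/

/-- The periodic interaction of a finite-range profile finite on `[0, ∞)` is finite at every configuration
(`L > 0`). [folklore] -/
theorem periodicInteraction_ne_top (hv : IsRepulsiveFiniteRange v) (hi : IsIntegrableProfile v) (hL : 0 < L)
    (X : Config (m + 1)) : periodicInteraction v L X ≠ ⊤ :=
  ENNReal.sum_ne_top.2 fun _ _ => ENNReal.sum_ne_top.2 fun _ _ =>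
    PlainInteraction.periodizedPotential_ne_top_of_finite hv hi.1 hL _

/-- **The real interaction of an integrable profile is integrable on the cell** (`∫_{cell^N} W < ∞`). [folklore] -/
theorem integrableOn_toReal_periodicInteraction (hv : IsRepulsiveFiniteRange v) (hi : IsIntegrableProfile v)
    (hL : 0 < L) :
    IntegrableOn (fun X : Config (m + 1) => (periodicInteraction v L X).toReal) (cellN (m + 1) L) :=
  integrable_toReal_of_lintegral_ne_top (PlainCost.measurable_periodicInteraction hv.1 L).aemeasurable
    (lintegral_cellN_periodicInteraction_ne_top_of_lintegral_ne_top hL hv.1 hi.2 (m + 1))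

/-! ## Sums and scalars in the interaction form (integrable real interaction) -/

/-- `𝓥(Σ_i F_i, g) = Σ_i 𝓥(F_i, g)` for continuous data and an integrable real interaction. [folklore] -/
theorem vform_sum_left {ι : Type*} (s : Finset ι)
    (hW : IntegrableOn (fun X : Config (m + 1) => (periodicInteraction v L X).toReal) (cellN (m + 1) L))
    {F : ι → Config (m + 1) → ℂ} (hF : ∀ i ∈ s, Continuous (F i)) {g : Config (m + 1) → ℂ}
    (hg : Continuous g) :
    vform v m L (∑ i ∈ s, F i) g = ∑ i ∈ s, vform v m L (F i) g := by
  unfold vform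
  simp only [Finset.sum_apply]
  exact PlainInteraction.form_sum_left_int s hW hF hg

/-- `𝓥(f, Σ_i G_i) = Σ_i 𝓥(f, G_i)` for continuous data and an integrable real interaction. [folklore] -/
theorem vform_sum_right {ι : Type*} (s : Finset ι)
    (hW : IntegrableOn (fun X : Config (m + 1) => (periodicInteraction v L X).toReal) (cellN (m + 1) L))
    {f : Config (m + 1) → ℂ} (hf : Continuous f) {G : ι → Config (m + 1) → ℂ}
    (hG : ∀ i ∈ s, Continuous (G i)) :
    vform v m L f (∑ i ∈ s, G i) = ∑ i ∈ s, vform v m L f (G i) := by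
  unfold vform
  simp only [Finset.sum_apply]
  exact PlainInteraction.form_sum_right_int s hW hf hG

/-- **Sesquilinear expansion of the interaction form** over a finite family with real coefficients
(continuous data, integrable real interaction). [folklore] -/
theorem vform_sum_sum {ι : Type*} (s : Finset ι)
    (hW : IntegrableOn (fun X : Config (m + 1) => (periodicInteraction v L X).toReal) (cellN (m + 1) L))
    {P : ι → Config (m + 1) → ℂ} (hP : ∀ i ∈ s, Continuous (P i)) (a b : ι → ℝ) :
    vform v m L (fun X => ∑ i ∈ s, (a i : ℂ) * P i X) (fun X => ∑ i ∈ s, (b i : ℂ) * P i X) =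
      ∑ i ∈ s, ∑ j ∈ s, ((a i * b j : ℝ) : ℂ) * vform v m L (P i) (P j) := by
  -- adapted from `SmoothCut.vform_sum_sum` (continuous real interaction)
  have hF : ∀ (c : ι → ℝ), ∀ i ∈ s, Continuous (fun X => (c i : ℂ) * P i X) := fun c i hi =>
    continuous_const.mul (hP i hi)
  rw [SmoothCut.blockSum_eq, SmoothCut.blockSum_eq,
    vform_sum_left s hW (hF a) (SharpCut.continuous_sum_fn s (hF b))]
  refine Finset.sum_congr rfl fun i hi => ?_
  rw [vform_sum_right s hW (hF a i hi) (hF b)]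
  refine Finset.sum_congr rfl fun j _ => ?_
  unfold vform
  rw [PlainInteraction.form_const_mul_left, PlainInteraction.form_const_mul_right, Complex.conj_ofReal,
    Complex.ofReal_mul]
  ring

/-! ## `Q_S`-bandwidth two at the level of sectors (from `interactionLocalityInt`) -/

/-- **Interaction locality at the level of sectors**, integrable class: `𝓥(Ψ^{(n)}, Ψ^{(n')}) = 0` whenever
`|n − n'| ≥ 3` (`interactionLocalityInt` entry by entry, `|T ∖ S| ≥ |T| − |S| ≥ 3`, and conjugate symmetry).
[folklore] -/
theorem vform_sectorBlock_far (hv : IsRepulsiveFiniteRange v) (hi : IsIntegrableProfile v) (hL : 0 < L)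
    {ψ : Config (m + 1) → ℂ} (hψ : Continuous ψ) {n n' : ℕ} (h : n' + 3 ≤ n ∨ n + 3 ≤ n') :
    vform v m L (sectorBlock m L (fun i => i = n) ψ) (sectorBlock m L (fun i => i = n') ψ) = 0 := by
  -- adapted from `SmoothCut.vform_sectorBlock_far` (finite continuous profile)
  have hW := integrableOn_toReal_periodicInteraction (m := m) hv hi hL
  have hQ : ∀ S : Finset (Fin (m + 1)), Continuous (modeProj (m + 1) L S ψ) := fun S =>
    continuous_modeProj S hψ
  have key : ∀ {a b : ℕ}, a + 3 ≤ b →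
      vform v m L (sectorBlock m L (fun i => i = a) ψ) (sectorBlock m L (fun i => i = b) ψ) = 0 := by
    intro a b hab
    unfold sectorBlock
    rw [vform_sum_left _ hW (fun S _ => hQ S) (SharpCut.continuous_sum_fn _ fun T _ => hQ T)]
    refine Finset.sum_eq_zero fun S hS => ?_
    rw [vform_sum_right _ hW (hQ S) fun T _ => hQ T]
    refine Finset.sum_eq_zero fun T hT => interactionLocalityInt v hv hi m L hL S T ?_ ψ hψ
    simp only [Finset.mem_filter] at hS hT
    have := Finset.le_card_sdiff S T
    omega
  rcases h with h | h
  · rw [PlainCost.vform_conj_symm, key h, map_zero]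
  · exact key h

/-! ## Finiteness for integrable profiles; weighted Cauchy–Schwarz -/

/-- `∫⁻ W|h|² = ofReal (Re 𝓥(h, h))` for continuous `h` and an integrable profile (the periodisation is finite
everywhere and the real interaction is integrable on the cell). [folklore] -/
theorem lintegral_W_eq (hv : IsRepulsiveFiniteRange v) (hi : IsIntegrableProfile v) (hL : 0 < L)
    {h : Config (m + 1) → ℂ} (hh : Continuous h) :
    ∫⁻ X in cellN (m + 1) L, periodicInteraction v L X * ((‖h X‖₊ : ℝ≥0∞)) ^ 2 =
      ENNReal.ofReal (vform v m L h h).re := by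
  rw [PlainCost.vform_self, Complex.ofReal_re,
    PlainInteraction.ofReal_integral_weight_norm_sq_int (integrableOn_toReal_periodicInteraction hv hi hL)
      (fun X => ENNReal.toReal_nonneg) hh]
  exact lintegral_congr fun X => by rw [ENNReal.ofReal_toReal (periodicInteraction_ne_top hv hi hL X)]

/-- The energy form of a `C¹` function is finite for an integrable profile. [folklore] -/
theorem eform_ne_top (hv : IsRepulsiveFiniteRange v) (hi : IsIntegrableProfile v) (hL : 0 < L)
    {h : Config (m + 1) → ℂ} (hh : ContDiff ℝ 1 h) : eform v L h ≠ ⊤ := by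
  rw [Bare.eform_eq_add, PlainCost.lintegral_kineticDensity_eq_ofReal hh, lintegral_W_eq hv hi hL hh.continuous]
  exact ENNReal.add_ne_top.2 ⟨ENNReal.ofReal_ne_top, ENNReal.ofReal_ne_top⟩

/-- **Weighted Cauchy–Schwarz and AM–GM**, integrable class: `|Re 𝓥(f, g)| ≤ (Re 𝓥(f, f) + Re 𝓥(g, g))/2` for
continuous `f, g`. [folklore] -/
theorem abs_re_vform_le (hv : IsRepulsiveFiniteRange v) (hi : IsIntegrableProfile v) (hL : 0 < L)
    {f g : Config (m + 1) → ℂ} (hf : Continuous f) (hg : Continuous g) :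
    |(vform v m L f g).re| ≤ ((vform v m L f f).re + (vform v m L g g).re) / 2 := by
  -- adapted from `SmoothCut.abs_re_vform_le` (continuous real interaction)
  have h := PlainInteraction.norm_form_le_sqrt_mul_sqrt_int (integrableOn_toReal_periodicInteraction hv hi hL)
    (fun X => ENNReal.toReal_nonneg) hf hg
  change ‖vform v m L f g‖ ≤ _ at h
  rw [PlainCost.vform_self, PlainCost.vform_self, Complex.ofReal_re, Complex.ofReal_re]
  set a := ∫ X in cellN (m + 1) L, (periodicInteraction v L X).toReal * ‖f X‖ ^ 2
  set b := ∫ X in cellN (m + 1) L, (periodicInteraction v L X).toReal * ‖g X‖ ^ 2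
  have h0 : ∀ u : Config (m + 1) → ℂ,
      0 ≤ ∫ X in cellN (m + 1) L, (periodicInteraction v L X).toReal * ‖u X‖ ^ 2 :=
    fun u => integral_nonneg fun X => mul_nonneg ENNReal.toReal_nonneg (sq_nonneg _)
  have hab : Real.sqrt a * Real.sqrt b ≤ (a + b) / 2 := by
    nlinarith [sq_nonneg (Real.sqrt a - Real.sqrt b), Real.sq_sqrt (h0 f), Real.sq_sqrt (h0 g)]
  exact ((Complex.abs_re_le_norm _).trans h).trans hab

end SmoothCutInt

open Literature.MathematicalPhysics.QuantumManyBody.BoseGas in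
open Summit.AtomisticToContinuum.BoseEinsteinCondensation.Cruxes.GDTransfer.DysonDressedWitness in
/-- **The smooth splitting inequality, integrable class** (registered sub-goal `smoothSplittingInt` of the spectral
seed programme, line `seeded-continuity`, crux `GDTransfer`): for an admissible profile finite on `[0, ∞)` with
integrable lift, cutting a periodic trial state with the Lipschitz partition of unity `χ_lo² + χ_hi² = 1` across the
middle band `[θ, 1 − β]` of `n̂₀/N` costs at most `8π²/((1−β−θ)²N²)` times the sector-pinched interaction
`D(Ψ) = Σ_n ∫W|Ψ^{(n)}|²` — the IMS identity in the band-diagonal `n̂₀`-grading (`kineticBlockDiagonal`: no kinetic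
cross terms; `Q_S`-bandwidth two of `𝓥` with integrable pair weights: only `|n − n'| ≤ 2` talk), weighted
Cauchy–Schwarz for the integrable weight, and the Lipschitz bound `|χ(n/N) − χ(n'/N)| ≤ π|n − n'|/(2(1−β−θ)N)`.
[folklore] (CyconFroeseKirschSimon1987 §3.1, IMS localisation; ReedSimonIV1978 §XIII.12; LSSY2005 App. A.) -/
theorem smoothSplittingInt : SmoothSplittingInt := by
  -- adapted from `smoothSplitting` (finite continuous profile): only the four `v`-dependent inputs change
  intro v hv hi m L hL θ β hθ hβ hθβ Ψ
  have hw : 0 < 1 - β - θ := by linarith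
  have hN : (0 : ℝ) < (m : ℝ) + 1 := by positivity
  set R : Finset ℕ := Finset.range (m + 2)
  set P : ℕ → Config (m + 1) → ℂ := fun n => sectorBlock m L (fun i => i = n) Ψ.ψ
  set cL : ℕ → ℝ := fun n => cutLo θ β ((n : ℝ) / ((m : ℝ) + 1))
  set cH : ℕ → ℝ := fun n => cutHi θ β ((n : ℝ) / ((m : ℝ) + 1))
  set F := smoothBlock m L (cutLo θ β) Ψ.ψ
  set G := smoothBlock m L (cutHi θ β) Ψ.ψ
  -- regularity; the three functions as combinations of sector blocks; finiteness
  have hP1 : ∀ n, ContDiff ℝ 1 (P n) := fun n => SectorBlock.contDiff_sectorBlock _ Ψ.contDiff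
  have hPc : ∀ n, Continuous (P n) := fun n => (hP1 n).continuous
  have hW := SmoothCutInt.integrableOn_toReal_periodicInteraction (m := m) hv hi hL
  have hF : F = fun X => ∑ n ∈ R, (cL n : ℂ) * P n X := SmoothCut.smoothBlock_eq_sum _ _
  have hG : G = fun X => ∑ n ∈ R, (cH n : ℂ) * P n X := SmoothCut.smoothBlock_eq_sum _ _
  have hψ : Ψ.ψ = fun X => ∑ n ∈ R, ((1 : ℝ) : ℂ) * P n X := SmoothCut.self_eq_sum _
  have hC1 : ∀ a : ℕ → ℝ, ContDiff ℝ 1 fun X => ∑ n ∈ R, (a n : ℂ) * P n X := fun a =>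
    ContDiff.sum fun n _ => contDiff_const.mul (hP1 n)
  have hF1 : ContDiff ℝ 1 F := hF ▸ hC1 cL
  have hG1 : ContDiff ℝ 1 G := hG ▸ hC1 cH
  have hEF : eform v L F ≠ ⊤ := SmoothCutInt.eform_ne_top hv hi hL hF1
  have hEG : eform v L G ≠ ⊤ := SmoothCutInt.eform_ne_top hv hi hL hG1
  have hEψ : eform v L Ψ.ψ ≠ ⊤ := SmoothCutInt.eform_ne_top hv hi hL Ψ.contDiff
  -- the forms of block sums as double sums over sectors (real parts)
  have tre : ∀ a : ℕ → ℝ, (tform m L (fun X => ∑ n ∈ R, (a n : ℂ) * P n X) (fun X => ∑ n ∈ R, (a n : ℂ) * P n X)).re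
      = ∑ n ∈ R, ∑ n' ∈ R, a n * a n' * (tform m L (P n) (P n')).re := fun a => by
    rw [SmoothCut.tform_sum_sum R (fun n _ => hP1 n), SmoothCut.re_sum_sum]
  have vre : ∀ a : ℕ → ℝ, (vform v m L (fun X => ∑ n ∈ R, (a n : ℂ) * P n X) (fun X => ∑ n ∈ R, (a n : ℂ) * P n X)).re
      = ∑ n ∈ R, ∑ n' ∈ R, a n * a n' * (vform v m L (P n) (P n')).re := fun a => by
    rw [SmoothCutInt.vform_sum_sum R hW (fun n _ => hPc n), SmoothCut.re_sum_sum]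
  -- regrouping of the three double sums into one
  have comb : ∀ Φ : ℕ → ℕ → ℝ,
      ∑ n ∈ R, ∑ n' ∈ R, cL n * cL n' * Φ n n' + ∑ n ∈ R, ∑ n' ∈ R, cH n * cH n' * Φ n n' -
          ∑ n ∈ R, ∑ n' ∈ R, (1 : ℝ) * 1 * Φ n n' =
        ∑ n ∈ R, ∑ n' ∈ R, (cL n * cL n' + cH n * cH n' - 1) * Φ n n' := by
    intro Φ
    rw [← Finset.sum_add_distrib, ← Finset.sum_sub_distrib]
    refine Finset.sum_congr rfl fun n _ => ?_
    rw [← Finset.sum_add_distrib, ← Finset.sum_sub_distrib]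
    exact Finset.sum_congr rfl fun n' _ => by ring
  have hunit : ∀ n, cL n ^ 2 + cH n ^ 2 = 1 := fun n => cutLo_sq_add_cutHi_sq θ β _
  -- kinetic part: the sectors are `t`-orthogonal and the diagonal coefficient vanishes
  have kin : ∑ n ∈ R, ∑ n' ∈ R, (cL n * cL n' + cH n * cH n' - 1) * (tform m L (P n) (P n')).re = 0 := by
    refine Finset.sum_eq_zero fun n _ => Finset.sum_eq_zero fun n' _ => ?_
    rcases eq_or_ne n n' with rfl | h
    · have h1 : cL n * cL n + cH n * cH n - 1 = 0 := by linear_combination hunit n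
      rw [h1, zero_mul]
    · rw [SmoothCut.tform_sectorBlock_ne hL Ψ.contDiff h, Complex.zero_re, mul_zero]
  -- interaction part: the combinatorial core with `K = 2B²`, `B = π/((1−β−θ)N)` the increment bound
  set B : ℝ := Real.pi / (((m : ℝ) + 1) * (1 - β - θ)) with hB
  have hlip : ∀ n n' : ℕ, n ≤ n' + 2 → n' ≤ n + 2 → (cL n - cL n') ^ 2 + (cH n - cH n') ^ 2 ≤ 2 * B ^ 2 := by
    intro n n' h1 h2
    have h1' : (n : ℝ) ≤ n' + 2 := by exact_mod_cast h1
    have h2' : (n' : ℝ) ≤ n + 2 := by exact_mod_cast h2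
    have hx : |(n : ℝ) / ((m : ℝ) + 1) - (n' : ℝ) / ((m : ℝ) + 1)| ≤ 2 / ((m : ℝ) + 1) := by
      rw [← sub_div, abs_div, abs_of_pos hN]
      exact div_le_div_of_nonneg_right (abs_le.2 ⟨by linarith, by linarith⟩) hN.le
    have hB' : Real.pi / 2 * |(n : ℝ) / ((m : ℝ) + 1) - (n' : ℝ) / ((m : ℝ) + 1)| / (1 - β - θ) ≤ B :=
      calc Real.pi / 2 * |(n : ℝ) / ((m : ℝ) + 1) - (n' : ℝ) / ((m : ℝ) + 1)| / (1 - β - θ)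
          ≤ Real.pi / 2 * (2 / ((m : ℝ) + 1)) / (1 - β - θ) := by gcongr
        _ = B := by rw [hB]; field_simp
    have hlo := sq_le_sq.2 (((abs_cutLo_sub_le hw ((n : ℝ) / ((m : ℝ) + 1)) ((n' : ℝ) / ((m : ℝ) + 1))).trans
      hB').trans (le_abs_self B))
    have hhi := sq_le_sq.2 (((abs_cutHi_sub_le hw ((n : ℝ) / ((m : ℝ) + 1)) ((n' : ℝ) / ((m : ℝ) + 1))).trans
      hB').trans (le_abs_self B))
    linarith
  have hD0 : ∀ n ∈ R, 0 ≤ (vform v m L (P n) (P n)).re := fun n _ => PlainCost.vform_self_re_nonneg _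
  have pot := SmoothCut.ims_sum_le R cL cH (fun n => (vform v m L (P n) (P n)).re)
    (fun n n' => (vform v m L (P n) (P n')).re) (by positivity) hunit hlip
    (fun n n' h => by rw [SmoothCutInt.vform_sectorBlock_far hv hi hL Ψ.contDiff.continuous h, Complex.zero_re])
    (fun n n' => SmoothCutInt.abs_re_vform_le hv hi hL (hPc n) (hPc n')) hD0
  -- the sector-pinched interaction in real terms, and the real inequality
  set D : ℝ := ∑ n ∈ R, (vform v m L (P n) (P n)).re with hD
  have hDnn : 0 ≤ D := Finset.sum_nonneg hD0
  have hSD : sectorDiagV v m L Ψ.ψ = ENNReal.ofReal D := by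
    rw [hD, ENNReal.ofReal_sum_of_nonneg hD0]
    exact Finset.sum_congr rfl fun n _ => SmoothCutInt.lintegral_W_eq hv hi hL (hPc n)
  set c : ℝ := 8 * Real.pi ^ 2 / ((1 - β - θ) ^ 2 * ((m : ℝ) + 1) ^ 2) with hc
  have hc0 : 0 ≤ c := by positivity
  have hKc : 5 / 2 * (2 * B ^ 2) ≤ c := by
    rw [hB, hc, div_pow, mul_pow, mul_comm (((m : ℝ) + 1) ^ 2), ← mul_assoc, mul_div_assoc']
    exact div_le_div_of_nonneg_right (by nlinarith [Real.pi_pos]) (by positivity)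
  have key : (eform v L F).toReal + (eform v L G).toReal ≤ (eform v L Ψ.ψ).toReal + c * D := by
    rw [PlainCost.eform_toReal_eq hv.1 hF1 hEF, PlainCost.eform_toReal_eq hv.1 hG1 hEG,
      PlainCost.eform_toReal_eq hv.1 Ψ.contDiff hEψ, hψ, hF, hG, tre, tre, tre, vre, vre, vre]
    have h1 := comb fun n n' => (tform m L (P n) (P n')).re
    have h2 := comb fun n n' => (vform v m L (P n) (P n')).re
    nlinarith [kin, pot, mul_le_mul_of_nonneg_right hKc hDnn, h1, h2]
  -- back to `ℝ≥0∞`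
  rw [hSD, ← eform_trialState v Ψ, ← ENNReal.ofReal_mul hc0,
    ← ENNReal.toReal_le_toReal (ENNReal.add_ne_top.2 ⟨hEF, hEG⟩)
      (ENNReal.add_ne_top.2 ⟨hEψ, ENNReal.ofReal_ne_top⟩),
    ENNReal.toReal_add hEF hEG, ENNReal.toReal_add hEψ ENNReal.ofReal_ne_top,
    ENNReal.toReal_ofReal (mul_nonneg hc0 hDnn)]
  exact key

end Summit.AtomisticToContinuum.BoseEinsteinCondensation.Cruxes.GDTransfer.Seeded

end
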